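import Mathlib
import Literature.MathematicalPhysics.QuantumLattice.HubbardBandShellVolume
import Literature.MathematicalPhysics.QuantumLattice.HubbardBandSectorCountingToolbox
import HarnessLib

/-!
# Route `KLProgramme` — crux K3 `KLRegimeTwoPointLimit` (stmt-HubbardSuperconductivity-19937), support:
# the tube reduction of the two-shell (particle–particle / particle–hole) phase space to the angular
# sublevel set of the translated band Fermi curve (DECOMP App. E Lemmas E.1 / E.3, first display)

Cell `gate-hubbard-kl`, seat p1b; paper note `HOME/prover-p1b/E1-NOTE.md` §3 Lemma 3.

The two-shell set of the square-lattice band at level `μ` and transfer `w`,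
`S_μ(w; ε₁, ε₂) = {k ∈ [-π, π)² : |ε(k) - μ| < ε₁, |ε(k - w) - μ| ≤ ε₂}` (both `k` and `k - w` near
the Fermi curve: the support of a particle–particle bubble at transfer `q = w`, or of a particle–hole
bubble at transfer `Q = -w`), has planar Lebesgue measure at most

  `16 L ε₁ · |{θ ∈ (-π, π) : |ε(p_μ(θ) - w) - μ| ≤ ε₂ + 4 L ε₁}|`        (`klta_volume_twoShell_le`),

`L = L(a', b')` the Lipschitz constant of the band Fermi radius in the level
(`exists_bandFermiRadius_sub_le`), for all levels with `μ ± ε₁` in a compact sub-band `[a', b']`: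
in polar coordinates the first shell is the radial window `u_{μ-ε₁}(θ) < r < u_{μ+ε₁}(θ)` of width
`≤ 2Lε₁` (as in the tree's shell-volume estimate `exists_shellVolume_le`, whose proof this file
follows line by line), and on it the second condition forces the angle into the sublevel set of the
translated level function with defect `4Lε₁` (`ε` is `2`-Lipschitz per coordinate). The angular
factor is then bounded by the seat's files `…ShellAngularTransversal` (Cooper and transversal regimes)
and, at the caustic, by `…ShellSecondOrder`.
-/

noncomputable section

-- the tree's namespace `Summit.<Summit>.<Problem>.Theorems` repeats the summit name by design (D-0017)
set_option linter.dupNamespace false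

open Real Set MeasureTheory
open scoped ENNReal
open Literature.MathematicalPhysics.QuantumLattice
open Literature.MathematicalPhysics.QuantumLattice.BandSectorCounting

namespace Summit.HubbardSuperconductivity.HubbardSuperconductivity.Theorems

/-- The planar two-shell set is measurable. -/
theorem klta_measurableSet_twoShell (μ ε₁ ε₂ w₁ w₂ : ℝ) :
    MeasurableSet {x : ℝ × ℝ | (x.1 ∈ Ico (-π) π ∧ x.2 ∈ Ico (-π) π) ∧
      |-2 * (Real.cos x.1 + Real.cos x.2) - μ| < ε₁ ∧
      |-2 * (Real.cos (x.1 - w₁) + Real.cos (x.2 - w₂)) - μ| ≤ ε₂} := by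
  have h1 : MeasurableSet {x : ℝ × ℝ | x.1 ∈ Ico (-π) π ∧ x.2 ∈ Ico (-π) π} := by
    have : {x : ℝ × ℝ | x.1 ∈ Ico (-π) π ∧ x.2 ∈ Ico (-π) π} = Ico (-π) π ×ˢ Ico (-π) π := by
      ext x; simp [mem_prod]
    rw [this]
    exact measurableSet_Ico.prod measurableSet_Ico
  have hc : Continuous fun x : ℝ × ℝ => |-2 * (Real.cos x.1 + Real.cos x.2) - μ| := by fun_prop
  have hc' : Continuous fun x : ℝ × ℝ => |-2 * (Real.cos (x.1 - w₁) + Real.cos (x.2 - w₂)) - μ| := by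
    fun_prop
  have hset : {x : ℝ × ℝ | (x.1 ∈ Ico (-π) π ∧ x.2 ∈ Ico (-π) π) ∧
      |-2 * (Real.cos x.1 + Real.cos x.2) - μ| < ε₁ ∧
      |-2 * (Real.cos (x.1 - w₁) + Real.cos (x.2 - w₂)) - μ| ≤ ε₂} =
      {x : ℝ × ℝ | x.1 ∈ Ico (-π) π ∧ x.2 ∈ Ico (-π) π} ∩
        ({x | |-2 * (Real.cos x.1 + Real.cos x.2) - μ| < ε₁} ∩
         {x | |-2 * (Real.cos (x.1 - w₁) + Real.cos (x.2 - w₂)) - μ| ≤ ε₂}) := by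
    ext x; simp only [mem_setOf_eq, mem_inter_iff]
  rw [hset]
  exact h1.inter ((measurableSet_lt hc.measurable measurable_const).inter
    (measurableSet_le hc'.measurable measurable_const))

/-- The angular sublevel set of the translated level function is measurable. -/
theorem klta_measurableSet_angular {μ : ℝ} (hμ₁ : -4 < μ) (hμ₂ : μ < 0) (w₁ w₂ δ : ℝ) :
    MeasurableSet {θ ∈ Ioo (-π) π | |eps2 (bandX μ θ - w₁) (bandY μ θ - w₂) - μ| ≤ δ} := by
  have hX : Continuous (bandX μ) := continuous_iff_continuousAt.2 fun t => (hasDerivAt_bandX hμ₁ hμ₂ t).continuousAt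
  have hY : Continuous (bandY μ) := continuous_iff_continuousAt.2 fun t => (hasDerivAt_bandY hμ₁ hμ₂ t).continuousAt
  have hc : Continuous fun θ => |eps2 (bandX μ θ - w₁) (bandY μ θ - w₂) - μ| := by
    unfold eps2; fun_prop
  have hset : {θ ∈ Ioo (-π) π | |eps2 (bandX μ θ - w₁) (bandY μ θ - w₂) - μ| ≤ δ} =
      Ioo (-π) π ∩ {θ | |eps2 (bandX μ θ - w₁) (bandY μ θ - w₂) - μ| ≤ δ} := by
    ext θ; simp only [mem_setOf_eq, mem_inter_iff]
  rw [hset]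
  exact measurableSet_Ioo.inter (measurableSet_le hc.measurable measurable_const)

/-- **Tube reduction of the two-shell phase space (Lemma E.1/E.3, first display).** For a compact
sub-band `[a', b'] ⊂ (-4, 0)` there is `L ≥ 0` such that for all levels `μ` with
`μ ± ε₁ ∈ [a', b']`, all `0 < ε₁`, all `ε₂` and all transfers `w`: the planar measure of
`{k ∈ [-π,π)² : |ε(k) - μ| < ε₁, |ε(k - w) - μ| ≤ ε₂}` is at most `16 L ε₁` times the measure of
the angular sublevel set `{θ ∈ (-π, π) : |ε(p_μ(θ) - w) - μ| ≤ ε₂ + 4 L ε₁}`. -/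
theorem klta_volume_twoShell_le {a' b' : ℝ} (ha' : -4 < a') (hb' : b' < 0) :
    ∃ L : ℝ, 0 ≤ L ∧ ∀ μ ε₁ ε₂ w₁ w₂ : ℝ, 0 < ε₁ → μ - ε₁ ∈ Icc a' b' → μ + ε₁ ∈ Icc a' b' →
      volume {x : ℝ × ℝ | (x.1 ∈ Ico (-π) π ∧ x.2 ∈ Ico (-π) π) ∧
          |-2 * (Real.cos x.1 + Real.cos x.2) - μ| < ε₁ ∧
          |-2 * (Real.cos (x.1 - w₁) + Real.cos (x.2 - w₂)) - μ| ≤ ε₂} ≤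
        ENNReal.ofReal (16 * L * ε₁) *
          volume {θ ∈ Ioo (-π) π | |eps2 (bandX μ θ - w₁) (bandY μ θ - w₂) - μ| ≤ ε₂ + 4 * L * ε₁} := by
  obtain ⟨L, hL0, hL⟩ := exists_bandFermiRadius_sub_le ha' hb'
  refine ⟨L, hL0, fun μ ε₁ ε₂ w₁ w₂ hε₁ hμ1 hμ2 => ?_⟩
  have hband : ∀ ν ∈ Icc a' b', -4 < ν ∧ ν < 0 := fun ν hν => ⟨ha'.trans_le hν.1, hν.2.trans_lt hb'⟩
  have hμ : μ ∈ Icc a' b' := ⟨by linarith [hμ1.1], by linarith [hμ2.2]⟩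
  obtain ⟨hm1, hm2⟩ := hband μ hμ
  set E' : Set (ℝ × ℝ) := {x : ℝ × ℝ | (x.1 ∈ Ico (-π) π ∧ x.2 ∈ Ico (-π) π) ∧
      |-2 * (Real.cos x.1 + Real.cos x.2) - μ| < ε₁ ∧
      |-2 * (Real.cos (x.1 - w₁) + Real.cos (x.2 - w₂)) - μ| ≤ ε₂} with hE'
  have hE'm : MeasurableSet E' := klta_measurableSet_twoShell μ ε₁ ε₂ w₁ w₂
  set δ := ε₂ + 4 * L * ε₁ with hδ
  set Θ : Set ℝ := {θ ∈ Ioo (-π) π | |eps2 (bandX μ θ - w₁) (bandY μ θ - w₂) - μ| ≤ δ} with hΘ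
  have hΘm : MeasurableSet Θ := klta_measurableSet_angular hm1 hm2 w₁ w₂ δ
  -- the radial window
  set R₁ : ℝ → ℝ := fun θ => bandFermiRadius (μ - ε₁) θ with hR₁
  set R₂ : ℝ → ℝ := fun θ => bandFermiRadius (μ + ε₁) θ with hR₂
  have hR₁c : Continuous R₁ := continuous_bandFermiRadius (hband _ hμ1).1 (hband _ hμ1).2
  have hR₂c : Continuous R₂ := continuous_bandFermiRadius (hband _ hμ2).1 (hband _ hμ2).2
  set Wset : Set (ℝ × ℝ) := {q : ℝ × ℝ | (R₁ q.2 < q.1 ∧ q.1 < R₂ q.2) ∧ q.2 ∈ Θ} with hWset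
  have hWm : MeasurableSet Wset :=
    ((measurableSet_lt (hR₁c.measurable.comp measurable_snd) measurable_fst).inter
      (measurableSet_lt measurable_fst (hR₂c.measurable.comp measurable_snd))).inter
      (measurable_snd hΘm)
  set g : ℝ × ℝ → ℝ≥0∞ := fun q => ENNReal.ofReal 8 * Wset.indicator (fun _ => (1 : ℝ≥0∞)) q with hg
  have hgm : Measurable g := (measurable_const.indicator hWm).const_mul _
  -- polar coordinates and the pointwise bound on the target
  have hpolar : volume E' = ∫⁻ q in polarCoord.target,
      ENNReal.ofReal q.1 • E'.indicator (1 : ℝ × ℝ → ℝ≥0∞) (polarCoord.symm q) := by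
    rw [lintegral_comp_polarCoord_symm (E'.indicator 1), lintegral_indicator_one hE'm]
  have hpt : ∀ q ∈ polarCoord.target,
      ENNReal.ofReal q.1 • E'.indicator (1 : ℝ × ℝ → ℝ≥0∞) (polarCoord.symm q) ≤ g q := by
    rintro ⟨r, θ⟩ hq
    simp only [polarCoord_target, mem_prod, mem_Ioi, mem_Ioo] at hq
    by_cases hmem : polarCoord.symm (r, θ) ∈ E'
    · rw [indicator_of_mem hmem, Pi.one_apply, smul_eq_mul, mul_one]
      simp only [polarCoord_symm_apply] at hmem
      obtain ⟨⟨hx, hy⟩, hε, hε₂⟩ := hmem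
      have hx' : |r * Real.cos θ| ≤ π := abs_le.2 ⟨hx.1, hx.2.le⟩
      have hy' : |r * Real.sin θ| ≤ π := abs_le.2 ⟨hy.1, hy.2.le⟩
      have hray : rayDispersion (θ, r) = -2 * (Real.cos (r * Real.cos θ) + Real.cos (r * Real.sin θ)) :=
        rayDispersion_eq (θ, r)
      rw [← hray] at hε
      have hwin := bandFermiRadius_lt_of_polar_mem (hband _ hμ1).1 (hband _ hμ1).2 (hband _ hμ2).1
        (hband _ hμ2).2 hq.1 hx' hy' (by linarith [(abs_lt.1 hε).1]) (by linarith [(abs_lt.1 hε).2])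
      have hr8 : r ≤ 8 := (polar_mem_square_bounds hq.1 hx' hy').2
      -- the angle lies in the sublevel set: `|r - u_μ(θ)| ≤ L ε₁`
      have hθI : θ ∈ Icc (-π) π := ⟨hq.2.1.le, hq.2.2.le⟩
      have hup : bandFermiRadius (μ + ε₁) θ - bandFermiRadius μ θ ≤ L * ε₁ := by
        have h := hL θ hθI μ hμ (μ + ε₁) hμ2 (by linarith)
        rwa [show μ + ε₁ - μ = ε₁ by ring] at h
      have hdn : bandFermiRadius μ θ - bandFermiRadius (μ - ε₁) θ ≤ L * ε₁ := by
        have h := hL θ hθI (μ - ε₁) hμ1 μ hμ (by linarith)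
        rwa [show μ - (μ - ε₁) = ε₁ by ring] at h
      have hru : |r - bandFermiRadius μ θ| ≤ L * ε₁ := by
        rw [abs_le]; constructor <;> linarith [hwin.1, hwin.2]
      have hΔx : |r * Real.cos θ - w₁ - (bandX μ θ - w₁)| ≤ L * ε₁ := by
        rw [show r * Real.cos θ - w₁ - (bandX μ θ - w₁) = (r - bandFermiRadius μ θ) * Real.cos θ by
          simp only [bandX]; ring, abs_mul]
        exact (mul_le_of_le_one_right (abs_nonneg _) (Real.abs_cos_le_one θ)).trans hru
      have hΔy : |r * Real.sin θ - w₂ - (bandY μ θ - w₂)| ≤ L * ε₁ := by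
        rw [show r * Real.sin θ - w₂ - (bandY μ θ - w₂) = (r - bandFermiRadius μ θ) * Real.sin θ by
          simp only [bandY]; ring, abs_mul]
        exact (mul_le_of_le_one_right (abs_nonneg _) (Real.abs_sin_le_one θ)).trans hru
      have hcmp := abs_eps2_sub_eps2_le (r * Real.cos θ - w₁) (r * Real.sin θ - w₂)
        (bandX μ θ - w₁) (bandY μ θ - w₂)
      have hε₂' : |eps2 (r * Real.cos θ - w₁) (r * Real.sin θ - w₂) - μ| ≤ ε₂ := by
        simpa only [eps2] using hε₂
      have hθΘ : θ ∈ Θ := by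
        refine ⟨hq.2, ?_⟩
        have htri := abs_sub_abs_le_abs_sub (eps2 (bandX μ θ - w₁) (bandY μ θ - w₂) - μ)
          (eps2 (r * Real.cos θ - w₁) (r * Real.sin θ - w₂) - μ)
        rw [show eps2 (bandX μ θ - w₁) (bandY μ θ - w₂) - μ -
            (eps2 (r * Real.cos θ - w₁) (r * Real.sin θ - w₂) - μ) =
            -(eps2 (r * Real.cos θ - w₁) (r * Real.sin θ - w₂) -
              eps2 (bandX μ θ - w₁) (bandY μ θ - w₂)) by ring, abs_neg] at htri
        rw [hδ]
        linarith
      rw [hg]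
      simp only
      rw [indicator_of_mem (show ((r, θ) : ℝ × ℝ) ∈ Wset from ⟨hwin, hθΘ⟩), mul_one]
      exact ENNReal.ofReal_le_ofReal hr8
    · rw [indicator_of_notMem hmem, smul_zero]
      exact bot_le
  -- integrate the bound
  have hI : ∫⁻ q in polarCoord.target, g q ≤ ENNReal.ofReal (16 * L * ε₁) * volume Θ := by
    rw [polarCoord_target, show (volume : Measure (ℝ × ℝ)) = (volume : Measure ℝ).prod volume from rfl,
      ← Measure.prod_restrict, lintegral_prod_symm _ hgm.aemeasurable]
    -- inner integral in `r`
    have hinner : ∀ θ ∈ Ioo (-π) π, ∫⁻ r in Ioi (0 : ℝ), g (r, θ) ≤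
        ENNReal.ofReal (8 * (L * (2 * ε₁))) * Θ.indicator 1 θ := by
      intro θ hθ
      have hθ' : θ ∈ Icc (-π) π := Ioo_subset_Icc_self hθ
      have hdiff : R₂ θ - R₁ θ ≤ L * (2 * ε₁) := by
        have h := hL θ hθ' (μ - ε₁) hμ1 (μ + ε₁) hμ2 (by linarith)
        rw [show μ + ε₁ - (μ - ε₁) = 2 * ε₁ by ring] at h
        exact h
      by_cases hθΘ : θ ∈ Θ
      · have hgr : ∀ r, g (r, θ) = ENNReal.ofReal 8 * (Ioo (R₁ θ) (R₂ θ)).indicator 1 r := fun r => by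
          simp only [hg, hWset, indicator, mem_setOf_eq, mem_Ioo, Pi.one_apply, hθΘ, and_true]
        rw [indicator_of_mem hθΘ, Pi.one_apply, mul_one]
        calc ∫⁻ r in Ioi (0 : ℝ), g (r, θ)
            ≤ ∫⁻ r, g (r, θ) := lintegral_mono' Measure.restrict_le_self le_rfl
          _ = ENNReal.ofReal 8 * volume (Ioo (R₁ θ) (R₂ θ)) := by
              simp_rw [hgr]
              rw [lintegral_const_mul' _ _ ENNReal.ofReal_ne_top, lintegral_indicator_one measurableSet_Ioo]
          _ = ENNReal.ofReal 8 * ENNReal.ofReal (R₂ θ - R₁ θ) := by rw [Real.volume_Ioo]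
          _ ≤ ENNReal.ofReal 8 * ENNReal.ofReal (L * (2 * ε₁)) := by gcongr
          _ = ENNReal.ofReal (8 * (L * (2 * ε₁))) := (ENNReal.ofReal_mul (by norm_num)).symm
      · have hgr : ∀ r, g (r, θ) = 0 := fun r => by
          simp only [hg, hWset, indicator, mem_setOf_eq, hθΘ, and_false, if_false, mul_zero]
        simp_rw [hgr]
        rw [lintegral_zero]
        exact bot_le
    have hΘi : Measurable fun θ => ENNReal.ofReal (8 * (L * (2 * ε₁))) * Θ.indicator (1 : ℝ → ℝ≥0∞) θ :=
      (measurable_const.indicator hΘm).const_mul _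
    calc ∫⁻ θ in Ioo (-π) π, ∫⁻ r in Ioi (0 : ℝ), g (r, θ)
        ≤ ∫⁻ θ in Ioo (-π) π, ENNReal.ofReal (8 * (L * (2 * ε₁))) * Θ.indicator 1 θ :=
          setLIntegral_mono hΘi hinner
      _ ≤ ∫⁻ θ, ENNReal.ofReal (8 * (L * (2 * ε₁))) * Θ.indicator 1 θ :=
          lintegral_mono' Measure.restrict_le_self le_rfl
      _ = ENNReal.ofReal (8 * (L * (2 * ε₁))) * volume Θ := by
          rw [lintegral_const_mul' _ _ ENNReal.ofReal_ne_top, lintegral_indicator_one hΘm]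
      _ = ENNReal.ofReal (16 * L * ε₁) * volume Θ := by
          congr 1; congr 1; ring
  calc volume E' = ∫⁻ q in polarCoord.target,
        ENNReal.ofReal q.1 • E'.indicator (1 : ℝ × ℝ → ℝ≥0∞) (polarCoord.symm q) := hpolar
    _ ≤ ∫⁻ q in polarCoord.target, g q := setLIntegral_mono hgm hpt
    _ ≤ ENNReal.ofReal (16 * L * ε₁) * volume Θ := hI

end Summit.HubbardSuperconductivity.HubbardSuperconductivity.Theorems

end
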